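import Summits.CriticalPhenomena.CardyFormulaZ2.Theses.CardyWickAnisotropy
import Summits.CriticalPhenomena.CardyFormulaZ2.Theorems.CardyWickAnisotropyVitaliStep
import Summits.CriticalPhenomena.CardyFormulaZ2.Theorems.CardyWickAnisotropyRealAxisDictionary
import Summits.CriticalPhenomena.CardyFormulaZ2.Theorems.CardyWickAnisotropyAnisotropicBoxCardyStubHalfPlanePrimitive
import Summits.CriticalPhenomena.CardyFormulaZ2.Theorems.CardyWickAnisotropyAnisotropicBoxCardyStubKzPrimitive
import Summits.CriticalPhenomena.CardyFormulaZ2.Theorems.CardyWickAnisotropyAnisotropicBoxCardyStubAngleMap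
import Summits.CriticalPhenomena.CardyFormulaZ2.Theorems.CardyWickAnisotropyAnisotropicBoxCardyStubEvenJets
import Literature.Analysis.Complex.VitaliConvergence
import HarnessLib

/-!
# Crux `CardyWickAnisotropy.AnisotropicBoxCardy` (stmt-CriticalPhenomena-14309), line `birth`:
# the analytic half of `TaylorIdentification` and the reduction of the crux to its percolation heart

Consolidation of the four landed stubs of the line (`stub_halfPlanePrimitive`, `stub_kzPrimitive`,
`stub_angleMap`, `stub_evenJets`):

* `cardySideContinuation` — **the Cardy side continues holomorphically to the disc**: there is `G`
  holomorphic on `D = ball (1/2) (1/2)` with `G (criticalWeight (α/2)) = Π_h (cot (α/2))` for every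
  `α ∈ (0, π)` (`Π_h r = cardyFunction (((θ₂/θ₃)(i r))⁴.re)`).  This is literally the existence half
  of the route item `TaylorIdentification` (stmt-CriticalPhenomena-14427), now a theorem:
  `G = Φ ∘ T` with `Φ` the Kleban–Zagier primitive on `ℍ` (`kzPrimitive_of_halfPlanePrimitive`
  fed with `halfPlanePrimitive`) and `T : D → ℍ` the weight-to-modulus dictionary
  (`anisotropicAngleMap`).
* `cardySideContinuation_unique` — any two such continuations agree on `D` (identity theorem from
  the critical segment), so the `∀ G` and `∃ G` phrasings of the jet statements are equivalent.
* `taylorIdentification_of_oddJets` — **`TaylorIdentification` reduces to the ODD jets**: given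
  convergence of the odd jets of the amplitudes `V n` at `p = 1/2` to those of every holomorphic
  continuation of the Cardy side, the route item `TaylorIdentification` holds (existence by
  `cardySideContinuation`, even jets by the landed `stub_evenJets`).
* `taylorIdentification_of_discNormality_of_anisotropicBoxCardy` — **tightness of the line**:
  conversely `DiscNormality → AnisotropicBoxCardy → TaylorIdentification` (Vitali–Porter: the
  normal family `V n` converges at the critical weights, which accumulate at `1/2`, hence locally
  uniformly on `D`, hence with all jets; tree `Literature.Analysis.Complex.VitaliConvergence`).  So,
  GIVEN `DiscNormality`, the crux, `TaylorIdentification` and the odd-jet stub are EQUIVALENT: the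
  line reformulates the crux, it does not weaken it.
* `anisotropicBoxCardy_of_discNormality_of_oddJets` — **the crux modulo its two open stubs**:
  `DiscNormality → OddJets → AnisotropicBoxCardy`, through the landed Vitali step and real-axis
  dictionary.  (`OddJets` is spelled out as a hypothesis; it is the registered stub `stub_oddJets`
  of the line and is conjecture-grade: already `k = 1` is the scaling limit
  `E_½[N^piv_h − N^piv_v]([0,n+1]×[0,n]) → 2√3·(−Π_h′(1)) = 1.80219…` on critical bond-`ℤ²`.)
-/

namespace Summit.CriticalPhenomena.CardyFormulaZ2.Theorems

open scoped Classical
open Summit.CriticalPhenomena.CardyFormulaZ2.Theses.CardyWickAnisotropy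
  (DiscNormality TaylorIdentification RealAxisDictionary VitaliStep AnisotropicBoxCardy)

/-- **The Cardy side continues holomorphically to the disc `D = ball (1/2) (1/2)`** (existence half
of `TaylorIdentification`, stmt-CriticalPhenomena-14427): there is `G` holomorphic on `D` with
`G (criticalWeight (α/2)) = Π_h (cot (α/2))` for all `α ∈ (0, π)`.  Proof: `G = Φ ∘ T`,
`Φ` holomorphic on `ℍ` with `Φ (i r) = Π_h r` (`kzPrimitive_of_halfPlanePrimitive halfPlanePrimitive`),
`T` holomorphic `D → ℍ` with `T (criticalWeight (α/2)) = i cot (α/2)` (`anisotropicAngleMap`), and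
`cot (α/2) > 0` on `(0, π)`. -/
theorem cardySideContinuation :
    let PiH : ℝ → ℝ := fun r ↦ Literature.Probability.RandomPlanarGeometry.cardyFunction (((Literature.NumberTheory.EllipticCurves.JacobiThetaNull.theta2 (Complex.I * (r : ℂ)) / Literature.NumberTheory.EllipticCurves.JacobiThetaNull.theta3 (Complex.I * (r : ℂ))) ^ 4).re); ∃ G : ℂ → ℂ, DifferentiableOn ℂ G (Metric.ball ((1:ℂ) / 2) (1 / 2)) ∧ ∀ α ∈ Set.Ioo (0:ℝ) Real.pi, G ((Literature.Probability.LatticeModels.criticalWeight (α / 2) : ℝ) : ℂ) = ((PiH (Real.cos (α / 2) / Real.sin (α / 2)) : ℝ) : ℂ) := by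
  have hK := kzPrimitive_of_halfPlanePrimitive halfPlanePrimitive
  dsimp only at hK ⊢
  obtain ⟨Φ, hΦ, hΦax⟩ := hK
  obtain ⟨T, hT, hTim, hTval⟩ := anisotropicAngleMap
  refine ⟨Φ ∘ T, hΦ.comp hT (fun p hp => hTim p hp), ?_⟩
  intro α hα
  have h1 : 0 < Real.cos (α / 2) :=
    Real.cos_pos_of_mem_Ioo ⟨by linarith [hα.1, Real.pi_pos], by linarith [hα.2]⟩
  have h2 : 0 < Real.sin (α / 2) :=
    Real.sin_pos_of_pos_of_lt_pi (by linarith [hα.1]) (by linarith [hα.2, Real.pi_pos])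
  have hr : 0 < Real.cos (α / 2) / Real.sin (α / 2) := div_pos h1 h2
  simp only [Function.comp_apply]
  rw [hTval α hα, hΦax _ hr]

/-- `criticalWeight (α/2) = 1/2` forces `α = π/2` on `(0, π)` (injectivity of `sin` on
`[-π/2, π/2]`).  (Same lemma as the private one in `…StubEvenJets.lean`.) -/
private theorem eq_pi_div_two_of_criticalWeight_eq_half {α : ℝ} (hα : α ∈ Set.Ioo (0:ℝ) Real.pi)
    (h : Literature.Probability.LatticeModels.criticalWeight (α / 2) = 1 / 2) : α = Real.pi / 2 := by
  unfold Literature.Probability.LatticeModels.criticalWeight at h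
  obtain ⟨h0, hπ⟩ := hα
  have ha : 0 < Real.sin (2 * (α / 2) / 3) :=
    Real.sin_pos_of_pos_of_lt_pi (by linarith) (by linarith [Real.pi_pos])
  have hb : 0 < Real.sin ((Real.pi - 2 * (α / 2)) / 3) :=
    Real.sin_pos_of_pos_of_lt_pi (by linarith) (by linarith [Real.pi_pos])
  rw [div_eq_iff (add_pos ha hb).ne'] at h
  have hab : Real.sin (2 * (α / 2) / 3) = Real.sin ((Real.pi - 2 * (α / 2)) / 3) := by
    linear_combination 2 * h
  have := Real.injOn_sin ⟨by linarith [Real.pi_pos], by linarith [Real.pi_pos]⟩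
    ⟨by linarith [Real.pi_pos], by linarith [Real.pi_pos]⟩ hab
  linarith

/-- The critical weights `criticalWeight (α/2)`, `α ∈ (0, π)`, accumulate at `1/2 = criticalWeight (π/4)`
inside the punctured neighbourhood filter: `α ↦ criticalWeight (α/2)` is continuous at `π/2` and takes the
value `1/2` only at `α = π/2` (on `(0, π)`), so every punctured neighbourhood of `1/2` in `ℂ` contains
such a weight.  (Same lemma as the private one in `…StubEvenJets.lean`, made public here.) -/
theorem frequently_mem_criticalWeights :
    ∃ᶠ z in nhdsWithin ((1:ℂ) / 2) {((1:ℂ) / 2)}ᶜ,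
      ∃ α ∈ Set.Ioo (0:ℝ) Real.pi, z = ((Literature.Probability.LatticeModels.criticalWeight (α / 2) : ℝ) : ℂ) := by
  set c : ℝ → ℂ := fun α ↦
    ((Literature.Probability.LatticeModels.criticalWeight (α / 2) : ℝ) : ℂ) with hc
  have hcval : c (Real.pi / 2) = (1:ℂ) / 2 := by
    simp only [hc, show Real.pi / 2 / 2 = Real.pi / 4 by ring,
      Literature.Probability.LatticeModels.criticalWeight_pi_div_four]
    push_cast; ring
  have hden : Real.sin (2 * (Real.pi / 2 / 2) / 3) + Real.sin ((Real.pi - 2 * (Real.pi / 2 / 2)) / 3) ≠ 0 := by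
    rw [show 2 * (Real.pi / 2 / 2) / 3 = Real.pi / 6 by ring,
      show (Real.pi - 2 * (Real.pi / 2 / 2)) / 3 = Real.pi / 6 by ring, Real.sin_pi_div_six]
    norm_num
  have hcont : ContinuousAt c (Real.pi / 2) := by
    have hf : Continuous fun α : ℝ ↦ Real.sin (2 * (α / 2) / 3) := by fun_prop
    have hg : Continuous fun α : ℝ ↦
        Real.sin (2 * (α / 2) / 3) + Real.sin ((Real.pi - 2 * (α / 2)) / 3) := by fun_prop
    have hcw : ContinuousAt
        (fun α : ℝ ↦ Literature.Probability.LatticeModels.criticalWeight (α / 2)) (Real.pi / 2) :=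
      hf.continuousAt.div hg.continuousAt hden
    exact Complex.continuous_ofReal.continuousAt.comp hcw
  have hIoo : ∀ᶠ α in nhdsWithin (Real.pi / 2) {Real.pi / 2}ᶜ, α ∈ Set.Ioo (0:ℝ) Real.pi :=
    eventually_nhdsWithin_of_eventually_nhds
      (isOpen_Ioo.mem_nhds ⟨by positivity, by linarith [Real.pi_pos]⟩)
  have hne : ∀ᶠ α in nhdsWithin (Real.pi / 2) {Real.pi / 2}ᶜ, c α ∈ ({(1:ℂ) / 2}ᶜ : Set ℂ) := by
    filter_upwards [hIoo, self_mem_nhdsWithin] with α hα hα'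
    intro hcα
    apply hα'
    apply eq_pi_div_two_of_criticalWeight_eq_half hα
    have h1 : c α = 1 / 2 := Set.mem_singleton_iff.1 hcα
    have h2 : ((Literature.Probability.LatticeModels.criticalWeight (α / 2) : ℝ) : ℂ) = 1 / 2 := h1
    apply Complex.ofReal_injective
    rw [h2]; push_cast; ring
  have hten : Filter.Tendsto c (nhdsWithin (Real.pi / 2) {Real.pi / 2}ᶜ)
      (nhdsWithin ((1:ℂ) / 2) {((1:ℂ) / 2)}ᶜ) :=
    tendsto_nhdsWithin_of_tendsto_nhds_of_eventually_within c
      (hcval ▸ hcont.tendsto.mono_left nhdsWithin_le_nhds) hne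
  exact hten.frequently (hIoo.mono fun α hα ↦ ⟨α, hα, rfl⟩).frequently

/-- **Uniqueness of the continuation**: two functions holomorphic on `D = ball (1/2) (1/2)` that agree at
every critical weight `criticalWeight (α/2)`, `α ∈ (0, π)`, agree on `D` (identity theorem; the weights
accumulate at `1/2 ∈ D`, `frequently_mem_criticalWeights`). -/
theorem cardySideContinuation_unique {G₁ G₂ : ℂ → ℂ}
    (h₁ : DifferentiableOn ℂ G₁ (Metric.ball ((1:ℂ) / 2) (1 / 2)))
    (h₂ : DifferentiableOn ℂ G₂ (Metric.ball ((1:ℂ) / 2) (1 / 2)))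
    (h : ∀ α ∈ Set.Ioo (0:ℝ) Real.pi,
      G₁ ((Literature.Probability.LatticeModels.criticalWeight (α / 2) : ℝ) : ℂ) =
        G₂ ((Literature.Probability.LatticeModels.criticalWeight (α / 2) : ℝ) : ℂ)) :
    Set.EqOn G₁ G₂ (Metric.ball ((1:ℂ) / 2) (1 / 2)) := by
  have hA₁ := h₁.analyticOnNhd Metric.isOpen_ball
  have hA₂ := h₂.analyticOnNhd Metric.isOpen_ball
  have h0 : ((1:ℂ) / 2) ∈ Metric.ball ((1:ℂ) / 2) (1 / 2) := Metric.mem_ball_self (by norm_num)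
  refine hA₁.eqOn_of_preconnected_of_frequently_eq hA₂ (convex_ball _ _).isPreconnected h0 ?_
  refine frequently_mem_criticalWeights.mono ?_
  rintro z ⟨α, hα, rfl⟩
  exact h α hα

/-- **`TaylorIdentification` reduces to the odd jets.**  If the ODD jets of the amplitudes `V n` at
`p = 1/2` converge to those of every holomorphic continuation of the Cardy side (the registered stub
`stub_oddJets` of line `birth`, spelled out), then the route item `TaylorIdentification`
(stmt-CriticalPhenomena-14427) holds: the continuation exists (`cardySideContinuation`) and the even
jets converge by the landed `stub_evenJets`. -/
theorem taylorIdentification_of_oddJets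
    (hOdd : let E : ℕ → Finset (Sym2 (Literature.Probability.LatticeModels.Site 2)) := fun n ↦ ((Literature.Probability.Percolation.rectangle (n + 1) n ×ˢ Literature.Probability.Percolation.rectangle (n + 1) n).filter (fun xy ↦ (Literature.Probability.LatticeModels.zdGraph 2).Adj xy.1 xy.2)).image (fun xy ↦ s(xy.1, xy.2)); let w : ℂ → Sym2 (Literature.Probability.LatticeModels.Site 2) → ℂ := fun p e ↦ if (∃ x y : Literature.Probability.LatticeModels.Site 2, e = s(x, y) ∧ x 1 = y 1) then p else 1 - p; let V : ℕ → ℂ → ℂ := fun n p ↦ ∑ ω ∈ (E n).powerset, (if ((ω : Set (Sym2 (Literature.Probability.LatticeModels.Site 2))) ∈ Literature.Probability.Percolation.lrCrossing (n + 1) n) then ∏ e ∈ E n, (if e ∈ ω then w p e else 1 - w p e) else 0); let PiH : ℝ → ℝ := fun r ↦ Literature.Probability.RandomPlanarGeometry.cardyFunction (((Literature.NumberTheory.EllipticCurves.JacobiThetaNull.theta2 (Complex.I * (r : ℂ)) / Literature.NumberTheory.EllipticCurves.JacobiThetaNull.theta3 (Complex.I * (r : ℂ))) ^ 4).re); ∀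 G : ℂ → ℂ, DifferentiableOn ℂ G (Metric.ball ((1:ℂ) / 2) (1 / 2)) → (∀ α ∈ Set.Ioo (0:ℝ) Real.pi, G ((Literature.Probability.LatticeModels.criticalWeight (α / 2) : ℝ) : ℂ) = ((PiH (Real.cos (α / 2) / Real.sin (α / 2)) : ℝ) : ℂ)) → ∀ k : ℕ, Odd k → Filter.Tendsto (fun n : ℕ ↦ iteratedDeriv k (V n) ((1:ℂ) / 2)) Filter.atTop (nhds (iteratedDeriv k G ((1:ℂ) / 2)))) :
    TaylorIdentification := by
  have hE := stub_evenJets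
  have hC := cardySideContinuation
  dsimp only at hOdd hE hC
  dsimp only [TaylorIdentification]
  obtain ⟨G, hG, hval⟩ := hC
  refine ⟨G, hG, hval, fun k => ?_⟩
  rcases Nat.even_or_odd k with hk | hk
  · exact hE G hG hval k hk
  · exact hOdd G hG hval k hk


/-! ### Tightness: under `DiscNormality` the crux gives back all the jets (Vitali–Porter) -/

/-- **Jets from normality and convergence at the critical weights.**  If the `V n` are entire,
uniformly bounded on each disc `‖2p - 1‖ ≤ ρ` (`ρ < 1`), `G` is holomorphic on `D = ball (1/2) (1/2)`
and `V n → G` pointwise at every critical weight `criticalWeight (α/2)`, `α ∈ (0, π)`, then every jet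
of `V n` at `1/2` converges to the corresponding jet of `G`: by Vitali's theorem
(`exists_tendstoLocallyUniformlyOn_of_frequently_tendsto`; the weights accumulate at `1/2`,
`frequently_mem_criticalWeights`) `V n → f` locally uniformly on `D` for some holomorphic `f`, which
agrees with `G` at the weights and hence on `D` (`cardySideContinuation_unique`), and locally uniform
convergence of holomorphic functions carries all derivatives (`TendstoLocallyUniformlyOn.deriv`). -/
theorem tendsto_iteratedDeriv_of_norm_le_of_tendsto_criticalWeights {V : ℕ → ℂ → ℂ} {G : ℂ → ℂ}
    (hV : ∀ n, Differentiable ℂ (V n))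
    (hN : ∀ ρ : ℝ, ρ < 1 → ∃ C : ℝ, ∀ n : ℕ, ∀ p : ℂ, ‖2 * p - 1‖ ≤ ρ → ‖V n p‖ ≤ C)
    (hG : DifferentiableOn ℂ G (Metric.ball ((1:ℂ) / 2) (1 / 2)))
    (hlim : ∀ α ∈ Set.Ioo (0:ℝ) Real.pi,
      Filter.Tendsto (fun n ↦ V n ((Literature.Probability.LatticeModels.criticalWeight (α / 2) : ℝ) : ℂ))
        Filter.atTop (nhds (G ((Literature.Probability.LatticeModels.criticalWeight (α / 2) : ℝ) : ℂ))))
    (k : ℕ) :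
    Filter.Tendsto (fun n ↦ iteratedDeriv k (V n) ((1:ℂ) / 2)) Filter.atTop
      (nhds (iteratedDeriv k G ((1:ℂ) / 2))) := by
  set D : Set ℂ := Metric.ball ((1:ℂ) / 2) (1 / 2) with hDdef
  have hD : IsOpen D := Metric.isOpen_ball
  have hDc : IsPreconnected D := (convex_ball _ _).isPreconnected
  have h0 : ((1:ℂ) / 2) ∈ D := Metric.mem_ball_self (by norm_num)
  -- local boundedness on `D` from the uniform bounds on the closed sub-discs
  have hb : ∀ a ∈ D, ∃ M : ℝ, ∃ r > 0, ∀ n, ∀ z ∈ Metric.ball a r ∩ D, ‖V n z‖ ≤ M := by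
    intro a ha
    have ha' : ‖a - 1 / 2‖ < 1 / 2 := by rwa [Metric.mem_ball, dist_eq_norm] at ha
    obtain ⟨C, hC⟩ := hN (2 * (‖a - 1 / 2‖ + (1 / 2 - ‖a - 1 / 2‖) / 2)) (by linarith)
    refine ⟨C, (1 / 2 - ‖a - 1 / 2‖) / 2, by linarith, fun n z hz ↦ hC n z ?_⟩
    have hza : ‖z - a‖ < (1 / 2 - ‖a - 1 / 2‖) / 2 := by
      rw [← dist_eq_norm]; exact hz.1
    have h2 : 2 * z - 1 = 2 * (z - a) + 2 * (a - 1 / 2) := by ring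
    calc ‖2 * z - 1‖ = ‖2 * (z - a) + 2 * (a - 1 / 2)‖ := by rw [h2]
      _ ≤ ‖2 * (z - a)‖ + ‖2 * (a - 1 / 2)‖ := norm_add_le _ _
      _ = 2 * ‖z - a‖ + 2 * ‖a - 1 / 2‖ := by simp
      _ ≤ 2 * (‖a - 1 / 2‖ + (1 / 2 - ‖a - 1 / 2‖) / 2) := by linarith
  -- pointwise convergence frequently near `1/2` (at the critical weights)
  have hS : ∃ᶠ z in nhdsWithin ((1:ℂ) / 2) {((1:ℂ) / 2)}ᶜ,
      ∃ c : ℂ, Filter.Tendsto (fun n ↦ V n z) Filter.atTop (nhds c) := by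
    refine frequently_mem_criticalWeights.mono ?_
    rintro z ⟨α, hα, rfl⟩
    exact ⟨_, hlim α hα⟩
  obtain ⟨f, hf, hVf⟩ :=
    Literature.Analysis.Complex.exists_tendstoLocallyUniformlyOn_of_frequently_tendsto hD hDc
      (fun n ↦ (hV n).differentiableOn) hb h0 hS
  -- the locally uniform limit is `G`
  have hfG : Set.EqOn f G D := by
    refine cardySideContinuation_unique hf hG fun α hα ↦ ?_
    exact tendsto_nhds_unique (hVf.tendsto_at (criticalWeight_half_mem_ball hα)) (hlim α hα)
  -- all derivatives converge locally uniformly on `D`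
  have hVa : ∀ n, AnalyticOnNhd ℂ (V n) D := fun n ↦ (hV n).differentiableOn.analyticOnNhd hD
  have hiter : ∀ m : ℕ, TendstoLocallyUniformlyOn (fun n ↦ deriv^[m] (V n)) (deriv^[m] f)
      Filter.atTop D := by
    intro m
    induction m with
    | zero => simpa using hVf
    | succ m ih =>
      have h1 := ih.deriv (Filter.Eventually.of_forall fun n ↦ ((hVa n).iterated_deriv m).differentiableOn) hD
      have e1 : (deriv ∘ fun n ↦ deriv^[m] (V n)) = fun n ↦ deriv^[m + 1] (V n) := by
        funext n
        simp only [Function.comp_apply, Function.iterate_succ_apply']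
      rwa [e1, ← Function.iterate_succ_apply' deriv m f] at h1
  have hk := (hiter k).tendsto_at h0
  have hEq : iteratedDeriv k f ((1:ℂ) / 2) = iteratedDeriv k G ((1:ℂ) / 2) :=
    Filter.EventuallyEq.iteratedDeriv_eq k (Filter.eventuallyEq_of_mem (hD.mem_nhds h0) hfG)
  rw [← hEq, iteratedDeriv_eq_iterate]
  simpa only [iteratedDeriv_eq_iterate] using hk

/-- **Tightness of the line** (`DiscNormality → AnisotropicBoxCardy → TaylorIdentification`): given
normality on `D`, the crux already forces the convergence of ALL jets of `V n` at the self-dual square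
to those of the (unique) holomorphic continuation of the Cardy side — Vitali–Porter on `D`, the `V n`
converging at the critical weights by the crux and the real-axis dictionary.  Hence, modulo
`DiscNormality`, the items `AnisotropicBoxCardy` and `TaylorIdentification` and the odd-jet stub of line
`birth` are equivalent. -/
theorem taylorIdentification_of_discNormality_of_anisotropicBoxCardy (hN : DiscNormality)
    (hA : AnisotropicBoxCardy) : TaylorIdentification := by
  have hC := cardySideContinuation
  have hU := realAxisDictionary_proof
  dsimp only [DiscNormality] at hN
  dsimp only [AnisotropicBoxCardy] at hA
  dsimp only [RealAxisDictionary] at hU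
  dsimp only at hC
  dsimp only [TaylorIdentification]
  obtain ⟨G, hG, hval⟩ := hC
  refine ⟨G, hG, hval, fun k ↦ ?_⟩
  refine tendsto_iteratedDeriv_of_norm_le_of_tendsto_criticalWeights ?_ hN hG ?_ k
  · -- each `V n` is a polynomial in `p`, hence entire (as in `vitaliStep_proof`)
    intro n
    refine Differentiable.fun_sum fun ω _ ↦ ?_
    by_cases hω : ((ω : Set (Sym2 (Literature.Probability.LatticeModels.Site 2))) ∈
        Literature.Probability.Percolation.lrCrossing (n + 1) n)
    · simp only [hω, ↓reduceIte]
      refine Differentiable.fun_finsetProd fun e _ ↦ ?_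
      by_cases he : e ∈ ω <;>
        by_cases hh : (∃ x y : Literature.Probability.LatticeModels.Site 2, e = s(x, y) ∧ x 1 = y 1) <;>
        simp only [he, hh, ↓reduceIte] <;> fun_prop
    · simp only [hω, ↓reduceIte]
      exact differentiable_const 0
  · -- convergence at the critical weights: the crux, read through the dictionary
    intro α hα
    have h1 := hA α hα
    rw [hval α hα]
    have h2 := (Complex.continuous_ofReal.tendsto _).comp h1
    refine h2.congr fun n ↦ ?_
    simp only [Function.comp_apply]
    exact (hU α hα n).symm

/-- **The crux modulo its two open stubs**: `DiscNormality` (route item stmt-CriticalPhenomena-10255)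
and the odd-jet convergence (registered stub `stub_oddJets` of line `birth`, spelled out) imply
`AnisotropicBoxCardy` — through `taylorIdentification_of_oddJets`, the landed Vitali step
`vitaliStep_proof : DiscNormality → TaylorIdentification → RealAxisDictionary → AnisotropicBoxCardy` and
the landed `realAxisDictionary_proof`. -/
theorem anisotropicBoxCardy_of_discNormality_of_oddJets (hN : DiscNormality)
    (hOdd : let E : ℕ → Finset (Sym2 (Literature.Probability.LatticeModels.Site 2)) := fun n ↦ ((Literature.Probability.Percolation.rectangle (n + 1) n ×ˢ Literature.Probability.Percolation.rectangle (n + 1) n).filter (fun xy ↦ (Literature.Probability.LatticeModels.zdGraph 2).Adj xy.1 xy.2)).image (fun xy ↦ s(xy.1, xy.2)); let w : ℂ → Sym2 (Literature.Probability.LatticeModels.Site 2) → ℂ := fun p e ↦ if (∃ x y : Literature.Probability.LatticeModels.Site 2, e = s(x, y) ∧ x 1 = y 1) then p else 1 - p; let V : ℕ → ℂ → ℂ := fun n p ↦ ∑ ω ∈ (E n).powerset, (if ((ω : Set (Sym2 (Literature.Probability.LatticeModels.Site 2))) ∈ Literature.Probability.Percolation.lrCrossing (n + 1) n) then ∏ e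 ∈ E n, (if e ∈ ω then w p e else 1 - w p e) else 0); let PiH : ℝ → ℝ := fun r ↦ Literature.Probability.RandomPlanarGeometry.cardyFunction (((Literature.NumberTheory.EllipticCurves.JacobiThetaNull.theta2 (Complex.I * (r : ℂ)) / Literature.NumberTheory.EllipticCurves.JacobiThetaNull.theta3 (Complex.I * (r : ℂ))) ^ 4).re); ∀ G : ℂ → ℂ, DifferentiableOn ℂ G (Metric.ball ((1:ℂ) / 2) (1 / 2)) → (∀ α ∈ Set.Ioo (0:ℝ) Real.pi, G ((Literature.Probability.LatticeModels.criticalWeight (α / 2) : ℝ) : ℂ) = ((PiH (Real.cos (α / 2) / Real.sin (α / 2)) : ℝ) : ℂ)) → ∀ k : ℕ, Odd k → Filter.Tendsto (fun n : ℕ ↦ iteratedDeriv k (V n) ((1:ℂ) / 2)) Filter.atTop (nhds (iteratedDeriv k G ((1:ℂ) / 2)))) :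
    AnisotropicBoxCardy :=
  vitaliStep_proof hN (taylorIdentification_of_oddJets hOdd) realAxisDictionary_proof

end Summit.CriticalPhenomena.CardyFormulaZ2.Theorems
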